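import Summits.KontsevichZagierPeriods.KontsevichZagierPeriods.Theorems.SoloInformedParamTerm
import HarnessLib

/-!
# Parametrised combinations and the definability invariant of bounded `KZ_ℝ` chains

A `SoloInformedPCombo K` is a finite `ℤ`-combination of parametrised terms
(`SoloInformedPTerm`, file `SoloInformedParamTerm`) over one parameter space `ℝ^K`; at a
parameter `p` it denotes `P.combo p = ∑_t coef_t • [ (P.term t).rep p ] ∈ KZOver.FormalRep ℝ`.
Combinations pull back along maps of parameter types and add (disjoint union of terms).

The invariant `SoloInformedDefinableRel c` of an element `c` of the free abelian group of real
representations: `c = P.combo p₀` for a combination whose set `V ∋ p₀` of good parameters is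
`ℚ`-SEMIALGEBRAIC, where good means: admissible, `P.combo p` is a bounded relation, and whenever all
fibres of `ℚ`-families at `p` are `ℚ`-semialgebraic (`SoloInformedRatFibres p`, e.g. `p` algebraic)
the combination lifts to a bounded relation over `ℚ` (`SoloInformedRatLift`). The invariant is
closed under the group law (`_zero`, `_neg`, `_add`: parameters `K₁ ⊕ K₂`), hence — by
`AddSubgroup.closure_induction` — holds on all of `soloInformedRelationsBdd ℝ` as soon as it holds on the four bounded generators
(`soloInformed_definableRel_of_mem_relationsBdd`). This is the shallow form of "validity of a
fixed-shape chain is a first-order condition on its real parameters" (THEOREM R / T, residency paper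
`real-parameters.md`).

References: [cite: KontsevichZagier2001, §1.2]; [cite: BochnakCosteRoy1998, §2.2, Prop. 5.2.3].
-/

noncomputable section

open Set MeasureTheory Literature.ModelTheory.ExponentialFields
  Literature.NumberTheory.Transcendental

namespace Summit.KontsevichZagierPeriods.KontsevichZagierPeriods.Theorems

/-- **A parametrised combination** over the parameter space `ℝ^K`: finitely many terms with
dimensions and integer coefficients. [cite: KontsevichZagier2001, §1.2] -/
structure SoloInformedPCombo (K : Type) : Type 1 where
  /-- index type of the terms -/
  ι : Type
  /-- finitely many terms -/
  hι : Fintype ι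
  /-- dimensions -/
  dim : ι → ℕ
  /-- the terms -/
  term : (t : ι) → SoloInformedPTerm K (dim t)
  /-- integer coefficients -/
  coef : ι → ℤ

attribute [instance] SoloInformedPCombo.hι

namespace SoloInformedPCombo

variable {K K' : Type} (P Q : SoloInformedPCombo K) (p : K → ℝ) (θ : K → K') (p' : K' → ℝ)

/-- The element of `KZOver.FormalRep ℝ` denoted at parameter `p`.
[cite: KontsevichZagier2001, §1.2] -/
def combo : KZOver.FormalRep ℝ := ∑ t, P.coef t • KZOver.of ((P.term t).rep p)

/-- All terms are admissible at `p`. [cite: KontsevichZagier2001, §1.1] -/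
def SoloInformedAdm (P : SoloInformedPCombo K) (p : K → ℝ) : Prop :=
  ∀ t, (P.term t).SoloInformedAdm p

/-- **Rational lift** at `p`: every denoted representation is the base change of a
`ℚ`-representation and the lifted combination is a bounded relation over `ℚ`.
[cite: KontsevichZagier2001, §1.2] -/
def SoloInformedRatLift (P : SoloInformedPCombo K) (p : K → ℝ) : Prop :=
  ∃ q : (t : P.ι) → KZOver.IntegralRep ℚ (P.dim t),
    (∀ t, (q t).baseChange ℝ = (P.term t).rep p) ∧
    ∑ t, P.coef t • KZOver.of (q t) ∈ soloInformedRelationsBdd ℚ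

/-- Pull-back of a combination along a map of parameter types. [cite: BochnakCosteRoy1998, §2.2] -/
def pullback : SoloInformedPCombo K' where
  ι := P.ι
  hι := P.hι
  dim := P.dim
  term t := (P.term t).pullback θ
  coef := P.coef

/-- The denoted element is invariant under pull-back. [cite: KontsevichZagier2001, §1.2] -/
theorem combo_pullback : (P.pullback θ).combo p' = P.combo (p' ∘ θ) := by
  show ∑ t : P.ι, P.coef t • KZOver.of (((P.term t).pullback θ).rep p') = _
  simp only [SoloInformedPTerm.rep_pullback, combo]

/-- Admissibility is invariant under pull-back. [cite: KontsevichZagier2001, §1.1] -/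
theorem adm_pullback_iff : (P.pullback θ).SoloInformedAdm p' ↔ P.SoloInformedAdm (p' ∘ θ) :=
  forall_congr' fun t => SoloInformedPTerm.adm_pullback_iff (P.term t) θ p'

/-- Rational lifts pull back. [cite: KontsevichZagier2001, §1.2] -/
theorem ratLift_pullback (h : P.SoloInformedRatLift (p' ∘ θ)) :
    (P.pullback θ).SoloInformedRatLift p' := by
  obtain ⟨q, hq, hrel⟩ := h
  exact ⟨q, fun t => (hq t).trans (SoloInformedPTerm.rep_pullback (P.term t) θ p').symm, hrel⟩

/-- Sum of two combinations over the same parameter space (disjoint union of the terms).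
[cite: KontsevichZagier2001, §1.2] -/
def add : SoloInformedPCombo K where
  ι := P.ι ⊕ Q.ι
  hι := inferInstance
  dim := Sum.elim P.dim Q.dim
  term t := match t with
    | Sum.inl a => P.term a
    | Sum.inr b => Q.term b
  coef := Sum.elim P.coef Q.coef

/-- The sum denotes the sum. [cite: KontsevichZagier2001, §1.2] -/
theorem combo_add : (P.add Q).combo p = P.combo p + Q.combo p := by
  show ∑ t : P.ι ⊕ Q.ι, (P.add Q).coef t • KZOver.of (((P.add Q).term t).rep p) = _
  rw [Fintype.sum_sum_type]
  rfl

/-- Admissibility of a sum. [cite: KontsevichZagier2001, §1.1] -/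
theorem adm_add (hP : P.SoloInformedAdm p) (hQ : Q.SoloInformedAdm p) :
    (P.add Q).SoloInformedAdm p := by
  rintro (a | b)
  · exact hP a
  · exact hQ b

/-- Rational lifts add. [cite: KontsevichZagier2001, §1.2] -/
theorem ratLift_add (hP : P.SoloInformedRatLift p) (hQ : Q.SoloInformedRatLift p) :
    (P.add Q).SoloInformedRatLift p := by
  obtain ⟨q₁, hq₁, h₁⟩ := hP
  obtain ⟨q₂, hq₂, h₂⟩ := hQ
  refine ⟨fun t => match t with
    | Sum.inl a => q₁ a
    | Sum.inr b => q₂ b, ?_, ?_⟩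
  · rintro (a | b)
    · exact hq₁ a
    · exact hq₂ b
  · show (∑ t : P.ι ⊕ Q.ι, _) ∈ _
    rw [Fintype.sum_sum_type]
    exact add_mem h₁ h₂

/-- Negative of a combination. [cite: KontsevichZagier2001, §1.2] -/
def neg : SoloInformedPCombo K where
  ι := P.ι
  hι := P.hι
  dim := P.dim
  term := P.term
  coef t := -P.coef t

/-- The negative denotes the negative. [cite: KontsevichZagier2001, §1.2] -/
theorem combo_neg : P.neg.combo p = -P.combo p := by
  show ∑ t : P.ι, -P.coef t • KZOver.of ((P.term t).rep p) = _
  simp only [neg_zsmul, Finset.sum_neg_distrib, combo]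

/-- Admissibility of the negative. [cite: KontsevichZagier2001, §1.1] -/
theorem adm_neg_iff : P.neg.SoloInformedAdm p ↔ P.SoloInformedAdm p := Iff.rfl

/-- Rational lifts of the negative. [cite: KontsevichZagier2001, §1.2] -/
theorem ratLift_neg (h : P.SoloInformedRatLift p) : P.neg.SoloInformedRatLift p := by
  obtain ⟨q, hq, hrel⟩ := h
  refine ⟨q, hq, ?_⟩
  show ∑ t : P.ι, -P.coef t • KZOver.of (q t) ∈ _
  simp only [neg_zsmul, Finset.sum_neg_distrib]
  exact neg_mem hrel

/-- The empty combination. [cite: KontsevichZagier2001, §1.2] -/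
def zero (K : Type) : SoloInformedPCombo K where
  ι := Fin 0
  hι := inferInstance
  dim _ := 0
  term t := Fin.elim0 t
  coef _ := 0

/-- The empty combination denotes `0`. [cite: KontsevichZagier2001, §1.2] -/
theorem combo_zero (p : K → ℝ) : (zero K).combo p = 0 := by
  simp [combo, zero]

/-- The empty combination is admissible. [cite: KontsevichZagier2001, §1.1] -/
theorem adm_zero (p : K → ℝ) : (zero K).SoloInformedAdm p := fun t => Fin.elim0 t

/-- The empty combination lifts. [cite: KontsevichZagier2001, §1.2] -/
theorem ratLift_zero (p : K → ℝ) : (zero K).SoloInformedRatLift p :=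
  ⟨fun t => Fin.elim0 t, fun t => Fin.elim0 t,
    by simp [zero, (soloInformedRelationsBdd ℚ).zero_mem]⟩

end SoloInformedPCombo

/-! ### Parameters with rational fibres -/

/-- All fibres at `p` of `ℚ`-semialgebraic families are `ℚ`-semialgebraic (holds at algebraic
points: `soloInformed_isSemialgebraic_rat_fibre_of_isAlgebraic`).
[cite: BochnakCosteRoy1998, Prop. 5.2.3] -/
def SoloInformedRatFibres {K : Type} (p : K → ℝ) : Prop :=
  ∀ (n : ℕ) (S : Set (K ⊕ Fin n → ℝ)), IsSemialgebraic ℚ S →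
    IsSemialgebraic ℚ {x : Fin n → ℝ | Sum.elim p x ∈ S}

/-- Rational fibres pass to parameters composed with a map of parameter types.
[cite: BochnakCosteRoy1998, §2.2] -/
theorem soloInformedRatFibres_comp {K K' : Type} {p' : K' → ℝ} (h : SoloInformedRatFibres p')
    (θ : K → K') : SoloInformedRatFibres (p' ∘ θ) := by
  intro n S hS
  have h' := h n {w | w ∘ Sum.map θ id ∈ S} (hS.preimage_comp _)
  convert h' using 1
  ext x
  simp only [mem_setOf_eq, SoloInformedPTerm.sumElim_comp_sumMap]

/-- At a parameter with rational fibres, the fibres of a term are `ℚ`-semialgebraic.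
[cite: BochnakCosteRoy1998, §2.2] -/
theorem soloInformedRatFibres.fibre {K : Type} {p : K → ℝ} (h : SoloInformedRatFibres p) {d : ℕ}
    (T : SoloInformedPTerm K d) : IsSemialgebraic ℚ (T.fibre p) ∧ IsSemialgebraic ℚ (T.gfibre p) :=
  ⟨h _ _ T.hS, h _ _ T.hG⟩

/-! ### The definability invariant -/

/-- **The definability invariant** of an element of `KZOver.FormalRep ℝ`: it is the value at a good
parameter of a parametrised combination whose good parameters form a `ℚ`-semialgebraic set (good =
admissible, denotes a bounded real relation, and lifts to a bounded rational relation at parameters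
with rational fibres). [cite: KontsevichZagier2001, §1.2] -/
def SoloInformedDefinableRel (c : KZOver.FormalRep ℝ) : Prop :=
  ∃ (K : Type) (_ : Fintype K) (P : SoloInformedPCombo K) (p₀ : K → ℝ) (V : Set (K → ℝ)),
    IsSemialgebraic ℚ V ∧ p₀ ∈ V ∧ P.combo p₀ = c ∧
    (∀ p ∈ V, P.SoloInformedAdm p ∧ P.combo p ∈ soloInformedRelationsBdd ℝ) ∧
    (∀ p ∈ V, SoloInformedRatFibres p → P.SoloInformedRatLift p)

/-- `0` is definable. [cite: KontsevichZagier2001, §1.2] -/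
theorem soloInformed_definableRel_zero : SoloInformedDefinableRel 0 :=
  ⟨Fin 0, inferInstance, SoloInformedPCombo.zero (Fin 0), Fin.elim0, univ, isSemialgebraic_univ,
    mem_univ _, SoloInformedPCombo.combo_zero _,
    fun p _ => ⟨SoloInformedPCombo.adm_zero p, by
      rw [SoloInformedPCombo.combo_zero]; exact (soloInformedRelationsBdd ℝ).zero_mem⟩,
    fun p _ _ => SoloInformedPCombo.ratLift_zero p⟩

/-- Definable elements are closed under negation. [cite: KontsevichZagier2001, §1.2] -/
theorem soloInformed_definableRel_neg {c : KZOver.FormalRep ℝ} (h : SoloInformedDefinableRel c) :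
    SoloInformedDefinableRel (-c) := by
  obtain ⟨K, hK, P, p₀, V, hV, hp₀, hc, hgood, hrat⟩ := h
  refine ⟨K, hK, P.neg, p₀, V, hV, hp₀, by rw [SoloInformedPCombo.combo_neg, hc], fun p hp =>
    ⟨(P.adm_neg_iff p).2 (hgood p hp).1, ?_⟩, fun p hp hr => P.ratLift_neg p (hrat p hp hr)⟩
  rw [SoloInformedPCombo.combo_neg]
  exact neg_mem (hgood p hp).2

/-- **Definable elements are closed under addition** (parameter spaces multiply: `K₁ ⊕ K₂`).
[cite: KontsevichZagier2001, §1.2] -/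
theorem soloInformed_definableRel_add {c₁ c₂ : KZOver.FormalRep ℝ}
    (h₁ : SoloInformedDefinableRel c₁) (h₂ : SoloInformedDefinableRel c₂) : SoloInformedDefinableRel (c₁ + c₂) := by
  obtain ⟨K₁, hK₁, P₁, p₁, V₁, hV₁, hp₁, hc₁, hgood₁, hrat₁⟩ := h₁
  obtain ⟨K₂, hK₂, P₂, p₂, V₂, hV₂, hp₂, hc₂, hgood₂, hrat₂⟩ := h₂
  refine ⟨K₁ ⊕ K₂, inferInstance, (P₁.pullback Sum.inl).add (P₂.pullback Sum.inr), Sum.elim p₁ p₂,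
    {p | p ∘ Sum.inl ∈ V₁} ∩ {p | p ∘ Sum.inr ∈ V₂},
    (hV₁.preimage_comp Sum.inl).inter (hV₂.preimage_comp Sum.inr),
    ⟨by simpa using hp₁, by simpa using hp₂⟩, ?_, fun p hp => ⟨?_, ?_⟩, fun p hp hr => ?_⟩
  · rw [SoloInformedPCombo.combo_add, SoloInformedPCombo.combo_pullback,
      SoloInformedPCombo.combo_pullback, Sum.elim_comp_inl, Sum.elim_comp_inr, hc₁, hc₂]
  · exact SoloInformedPCombo.adm_add _ _ p
      ((P₁.adm_pullback_iff Sum.inl p).2 (hgood₁ _ hp.1).1)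
      ((P₂.adm_pullback_iff Sum.inr p).2 (hgood₂ _ hp.2).1)
  · rw [SoloInformedPCombo.combo_add, SoloInformedPCombo.combo_pullback,
      SoloInformedPCombo.combo_pullback]
    exact add_mem (hgood₁ _ hp.1).2 (hgood₂ _ hp.2).2
  · exact SoloInformedPCombo.ratLift_add _ _ p
      (P₁.ratLift_pullback Sum.inl p (hrat₁ _ hp.1 (soloInformedRatFibres_comp hr Sum.inl)))
      (P₂.ratLift_pullback Sum.inr p (hrat₂ _ hp.2 (soloInformedRatFibres_comp hr Sum.inr)))

/-- **Closure induction.** If the four bounded generators of `KZ_ℝ` are definable, every bounded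
real relation is definable. [cite: KontsevichZagier2001, §1.2] -/
theorem soloInformed_definableRel_of_mem_relationsBdd
    (hgen : ∀ c ∈ soloInformedBddGenerators ℝ, SoloInformedDefinableRel c)
    {c : KZOver.FormalRep ℝ} (hc : c ∈ soloInformedRelationsBdd ℝ) :
    SoloInformedDefinableRel c := by
  induction hc using AddSubgroup.closure_induction with
  | mem x hx => exact hgen x hx
  | zero => exact soloInformed_definableRel_zero
  | add x y _ _ hx hy => exact soloInformed_definableRel_add hx hy
  | neg x _ hx => exact soloInformed_definableRel_neg hx

end Summit.KontsevichZagierPeriods.KontsevichZagierPeriods.Theorems
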